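import Summits.QuantumFields.YangMills.Theorems.FradkinShenkerFlowStrongPinningPoincareHeatBathKR
import Summits.QuantumFields.YangMills.Theorems.FradkinShenkerFlowStrongPinningPoincareTorus
import Literature.MathematicalPhysics.QuantumLattice.TorusWilsonGibbs

/-!
# `StrongPinningPoincare` from the one-link Laplace concentration estimate

Route `FradkinShenkerFlow` of `YangMills`, support item `stmt-QuantumFields-9446`
(`Summit.QuantumFields.YangMills.Theses.FradkinShenkerFlow.StrongPinningPoincare`): the pinned
Wilson measures `μ^{s,X} ∝ exp(s ∑_ℓ Re tr ρ(X_ℓ⁻¹ W_ℓ)) μ_{β,S}` satisfy a heat-bath Poincaré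
inequality with a constant uniform in `β ≥ 0`, `s ≥ c(1+β)`, the volume and the background `X`.

This file reduces the item to ONE analytic input on the single group `G` — the Laplace-regime
variance bound `hOL` for strongly pinned one-link laws (Lipschitz observables have variance
`≤ K₁ Lip²/s` under `Haar.tilted (s Re tr ρ(h⁻¹g) + β W)`, `W` a combination with weights in
`[-1, 1]` of words of length four in `ρ(g)^{±1}` and constants, at most `32` of which contain the
variable, uniformly, once `s ≥ c₀(1+β)`) — and proves everything else:
the abstract Kantorovich–Rubinstein-Dobrushin ⇒ heat-bath-Poincaré theorem
(`HeatBath.variance_le_of_kr`), the Kantorovich–Rubinstein perturbation lemma of the tree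
(`abs_integral_tilted_add_sub_le`), the mixed Lipschitz bound for the Wilson action with
volume-uniform column sums (`Lattice.abs_dd_wilsonAction_le`, `Lattice.sum_sum_slotCount_mul_le`),
and the identification of the pinned measure and its one-link laws with the abstract Gibbs
measure `(Haar^{⊗E}).tilted V`, `V = −β S_W + s ∑_ℓ Re tr ρ(X_ℓ⁻¹ U_ℓ)`. Constants:
`c = max (max c₀ 1) (128 K₁ √N)`, `C = 1`.
-/

noncomputable section

open MeasureTheory Function Real
open scoped Matrix
open Literature.MathematicalPhysics.QuantumFieldTheory

namespace Summit.QuantumFields.YangMills.Theorems.StrongPinningPoincare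

/-- **`StrongPinningPoincare` from one-link Laplace concentration.** If for every compact simple
`G` with lattice representation `r` there are `c₀, K₁ > 0` such that for `β ≥ 0`, `s ≥ c₀(1+β)`,
every pinning centre `h` and every word perturbation `W(g) = ∑ₘ wₘ Re tr(word_m(g))` (weights
`|wₘ| ≤ 1`, letters `ρ(g)^{(ᴴ)}` or constants, at most `32` words containing the variable) the
one-link law `Haar.tilted (g ↦ s Re tr ρ(h⁻¹g) + β W(g))` gives every bounded measurable `ψ`
with `|ψ a − ψ b| ≤ M ‖ρ a − ρ b‖_F` variance at most `M² K₁ / s`, then `StrongPinningPoincare`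
holds (with `c = max (max c₀ 1) (128 K₁ √N)`, `C = 1`): the one-link conditional laws of the
pinned Wilson measure along the Kantorovich–Rubinstein interpolation are of this form (the two
backgrounds contribute at most `16` words each that see the link, `Lattice.sum_slotCount_le`).
[folklore] -/
theorem strongPinningPoincare_of_oneLinkLaplace
    (hOL : ∀ (G : Type) [Group G] [TopologicalSpace G] [IsTopologicalGroup G] [CompactSpace G]
      [MeasurableSpace G] [BorelSpace G], IsCompactSimpleLieGroup G →
      ∀ (r : LatticeRep G), ∃ c₀ K₁ : ℝ, 0 < c₀ ∧ 0 < K₁ ∧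
        ∀ (β : ℝ), 0 ≤ β → ∀ (s : ℝ), c₀ * (1 + β) ≤ s →
          ∀ (h : G) (Λ : Type) [Fintype Λ] (w : Λ → ℝ) (v : Λ → Fin 4 → Option G),
          (∀ m, |w m| ≤ 1) → (∀ T : Finset Λ, (∀ m ∈ T, ∃ k, v m k = none) → T.card ≤ 32) →
          ∀ (ψ : G → ℝ) (M : ℝ), Measurable ψ → (∃ C, ∀ g, |ψ g| ≤ C) → 0 ≤ M →
          (∀ a b, |ψ a - ψ b| ≤ M * frobNorm (r.ρ a - r.ρ b)) →
          ∫ g, (ψ g - ∫ g', ψ g' ∂((haarProbability G).tilted (fun g => s * (r.ρ (h⁻¹ * g)).trace.re +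
              β * ∑ m, w m * (r.ρ ((v m 0).getD g) * r.ρ ((v m 1).getD g) *
                (r.ρ ((v m 2).getD g))ᴴ * (r.ρ ((v m 3).getD g))ᴴ).trace.re))) ^ 2
            ∂((haarProbability G).tilted (fun g => s * (r.ρ (h⁻¹ * g)).trace.re +
              β * ∑ m, w m * (r.ρ ((v m 0).getD g) * r.ρ ((v m 1).getD g) *
                (r.ρ ((v m 2).getD g))ᴴ * (r.ρ ((v m 3).getD g))ᴴ).trace.re))
            ≤ M ^ 2 / (s / K₁)) :
    Summit.QuantumFields.YangMills.Theses.FradkinShenkerFlow.StrongPinningPoincare := by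
  intro G _ _ _ _ _ _ hG r
  classical
  obtain ⟨c₀, K₁, hc₀, hK₁, hOL'⟩ := hOL G hG r
  haveI : SecondCountableTopology G :=
    (r.continuous.isClosedEmbedding r.injective).isEmbedding.secondCountableTopology
  haveI : T2Space G := (r.continuous.isClosedEmbedding r.injective).isEmbedding.t2Space
  refine ⟨max (max c₀ 1) (128 * K₁ * Real.sqrt r.N), 1, ?_⟩
  intro β hβ s hs S X F hF hFb
  obtain ⟨M, hM⟩ := hFb
  -- constants
  have h1β : (1 : ℝ) ≤ 1 + β := by linarith
  have hcs : max (max c₀ 1) (128 * K₁ * Real.sqrt r.N) ≤ s :=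
    le_trans (le_mul_of_one_le_right (le_trans zero_le_one
      ((le_max_right c₀ 1).trans (le_max_left _ _))) h1β) hs
  have hs1 : 1 ≤ s := le_trans ((le_max_right c₀ 1).trans (le_max_left _ _)) hcs
  have hspos : 0 < s := by linarith
  have hsc₀ : c₀ * (1 + β) ≤ s :=
    le_trans (mul_le_mul_of_nonneg_right ((le_max_left c₀ 1).trans (le_max_left _ _))
      (by linarith)) hs
  have hs128 : 128 * K₁ * Real.sqrt r.N * β ≤ s := by
    have h1 : 128 * K₁ * Real.sqrt r.N ≤ s := (le_max_right _ _).trans hcs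
    have h2 : 128 * K₁ * Real.sqrt r.N * (1 + β) ≤ s :=
      le_trans (mul_le_mul_of_nonneg_right (le_max_right _ _) (by linarith)) hs
    nlinarith [Real.sqrt_nonneg (r.N : ℝ)]
  -- the log-density `V = -β S_W + s · pin_X`
  set pin : GaugeConfig 4 (2 * S + 1) G → ℝ := fun U => ∑ ℓ, (r.ρ ((X ℓ)⁻¹ * U ℓ)).trace.re
    with hpin
  set V : GaugeConfig 4 (2 * S + 1) G → ℝ := fun U => -β * wilsonAction r.ρ U + s * pin U with hV
  have hpinm : Measurable pin := by
    refine Finset.measurable_sum _ fun ℓ _ => ?_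
    exact (Lattice.continuous_re_trace_mul r.ρ r.continuous _).measurable.comp (measurable_pi_apply ℓ)
  have hVm : Measurable V :=
    ((measurable_wilsonAction r.ρ r.continuous).const_mul _).add (hpinm.const_mul _)
  obtain ⟨B₁, hB₁⟩ := exists_abs_wilsonAction_le (d := 4) (L := 2 * S + 1) (G := G) r.ρ r.continuous
  have hpinb : ∀ U, |pin U| ≤ Fintype.card (Edge 4 (2 * S + 1)) * r.N := fun U => by
    refine (Finset.abs_sum_le_sum_abs _ _).trans ?_
    calc ∑ ℓ, |(r.ρ ((X ℓ)⁻¹ * U ℓ)).trace.re| ≤ ∑ _ℓ : Edge 4 (2 * S + 1), (r.N : ℝ) :=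
          Finset.sum_le_sum fun ℓ _ => Lattice.abs_re_trace_unitary_le (r.mem_unitary _)
      _ = Fintype.card (Edge 4 (2 * S + 1)) * r.N := by
          rw [Finset.sum_const, Finset.card_univ, nsmul_eq_mul]
  have hVb : ∀ U, |V U| ≤ |β| * B₁ + |s| * (Fintype.card (Edge 4 (2 * S + 1)) * r.N) := fun U => by
    calc |V U| ≤ |-β * wilsonAction r.ρ U| + |s * pin U| := abs_add_le _ _
      _ ≤ |β| * B₁ + |s| * (Fintype.card (Edge 4 (2 * S + 1)) * r.N) := by
          rw [abs_mul, abs_mul, abs_neg]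
          exact add_le_add (mul_le_mul_of_nonneg_left (hB₁ U) (abs_nonneg _))
            (mul_le_mul_of_nonneg_left (hpinb U) (abs_nonneg _))
  -- the Frobenius distance through `ρ`
  set dG : G → G → ℝ := fun a b => frobNorm (r.ρ a - r.ρ b) with hdG
  have hdc : Continuous fun p : G × G => dG p.1 p.2 :=
    Lattice.continuous_frobNorm.comp ((r.continuous.comp continuous_fst).sub
      (r.continuous.comp continuous_snd))
  have hd0 : ∀ e, dG e e = 0 := fun e => by simp [hdG, frobNorm_zero]
  have hdnn : ∀ e e', 0 ≤ dG e e' := fun e e' => frobNorm_nonneg _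
  have hdsymm : ∀ e e', dG e e' = dG e' e := fun e e' => frobNorm_sub_comm _ _
  have hdtri : ∀ a b c, dG a c ≤ dG a b + dG b c := fun a b c => frobNorm_sub_le _ _ _
  have hdsep : ∀ e e', dG e e' = 0 → e = e' := fun e e' h =>
    r.injective (sub_eq_zero.1 (Lattice.eq_zero_of_frobNorm_eq_zero h))
  have hdD : ∀ e e', dG e e' ≤ 2 * Real.sqrt r.N := fun e e' => by
    have h := frobNorm_sub_le_of_mem_unitaryGroup (r.mem_unitary e) (r.mem_unitary e')
    rwa [Fintype.card_fin] at h
  -- the interaction matrix: `c i j = (K₁ β √N / s) m(i,j)`, `m(i,j) = ∑ₚ nᵢ(p) nⱼ(p)`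
  set m : Edge 4 (2 * S + 1) → Edge 4 (2 * S + 1) → ℝ := fun i j => ∑ p : Plaquette 4 (2 * S + 1),
    (∑ k : Fin 4, if (![(p.1, p.2.1.1), (p.1.shift p.2.1.1, p.2.1.2), (p.1.shift p.2.1.2, p.2.1.1),
      (p.1, p.2.1.2)] : Fin 4 → Edge 4 (2 * S + 1)) k = i then (1 : ℝ) else 0) *
    (∑ k : Fin 4, if (![(p.1, p.2.1.1), (p.1.shift p.2.1.1, p.2.1.2), (p.1.shift p.2.1.2, p.2.1.1),
      (p.1, p.2.1.2)] : Fin 4 → Edge 4 (2 * S + 1)) k = j then (1 : ℝ) else 0) with hm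
  have hm0 : ∀ i j, 0 ≤ m i j := fun i j => Finset.sum_nonneg fun p _ =>
    mul_nonneg (Finset.sum_nonneg fun k _ => by positivity) (Finset.sum_nonneg fun k _ => by positivity)
  have hmsum : ∀ j, ∑ i, m i j ≤ 64 := fun j =>
    (Lattice.sum_sum_slotCount_mul_le (d := 4) (L := 2 * S + 1) j).trans (by norm_num)
  set c : Edge 4 (2 * S + 1) → Edge 4 (2 * S + 1) → ℝ := fun i j =>
    K₁ * β * Real.sqrt r.N / s * m i j with hc
  have hθ : 0 ≤ K₁ * β * Real.sqrt r.N / s := by positivity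
  have hcsum : ∀ j, ∑ i ∈ Finset.univ.erase j, c i j ≤ 1 - 1 / 2 := fun j => by
    calc ∑ i ∈ Finset.univ.erase j, c i j ≤ ∑ i, c i j :=
          Finset.sum_le_sum_of_subset_of_nonneg (Finset.erase_subset _ _)
            fun i _ _ => mul_nonneg hθ (hm0 i j)
      _ = K₁ * β * Real.sqrt r.N / s * ∑ i, m i j := by rw [Finset.mul_sum]
      _ ≤ K₁ * β * Real.sqrt r.N / s * 64 := mul_le_mul_of_nonneg_left (hmsum j) hθ
      _ ≤ 1 - 1 / 2 := by
          rw [div_mul_eq_mul_div, div_le_iff₀ hspos]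
          nlinarith
  -- the one-site Kantorovich–Rubinstein condition
  have hKR : ∀ (i j : Edge 4 (2 * S + 1)), i ≠ j → ∀ (x : GaugeConfig 4 (2 * S + 1) G) (a : G)
      (ψ : G → ℝ) (L Mψ : ℝ), Measurable ψ → (∀ e, |ψ e| ≤ Mψ) → 0 ≤ L →
      (∀ e e', |ψ e - ψ e'| ≤ L * dG e e') →
      |∫ e, ψ e ∂((haarProbability G).tilted fun e => V (update x i e)) -
        ∫ e, ψ e ∂((haarProbability G).tilted fun e => V (update (update x j a) i e))| ≤
        L * c i j * dG (x j) a := by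
    intro i j hij x a ψ L Mψ hψm hψb hL0 hψL
    set f : G → ℝ := fun u => V (update x i u) with hf
    set w : G → ℝ := fun u => V (update (update x j a) i u) - V (update x i u) with hw
    have hfw : (fun u => f u + w u) = fun u => V (update (update x j a) i u) := by
      funext u; simp only [hf, hw]; ring
    have hfm : Measurable f := hVm.comp (measurable_update x)
    have hfb : ∃ C, ∀ u, |f u| ≤ C := ⟨_, fun u => hVb _⟩
    have hwm : Measurable w := (hVm.comp (measurable_update _)).sub hfm
    have hwB : ∀ u, |w u| ≤ (|β| * B₁ + |s| * (Fintype.card (Edge 4 (2 * S + 1)) * r.N)) +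
        (|β| * B₁ + |s| * (Fintype.card (Edge 4 (2 * S + 1)) * r.N)) := fun u =>
      (abs_sub _ _).trans (add_le_add (hVb _) (hVb _))
    -- the mixed Lipschitz bound for `w`
    set Dw : ℝ := β * Real.sqrt r.N * m i j * dG (x j) a with hDw
    have hDw0 : 0 ≤ Dw := by
      have := hm0 i j; have := hdnn (x j) a; positivity
    have hwD : ∀ u u', |w u - w u'| ≤ Dw * dG u u' := fun u u' => by
      have hdd := Lattice.abs_dd_wilsonAction_le (d := 4) (L := 2 * S + 1) r.ρ r.mem_unitary x hij a u u'
      have e1 : w u - w u' = -β * (wilsonAction r.ρ (update (update x j a) i u) -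
          wilsonAction r.ρ (update x i u) - wilsonAction r.ρ (update (update x j a) i u') +
          wilsonAction r.ρ (update x i u')) := by
        simp only [hw, hV, hpin, Lattice.sum_pin_update]
        ring
      rw [e1, abs_mul, abs_neg, abs_of_nonneg hβ]
      calc β * _ ≤ β * (Real.sqrt r.N * frobNorm (r.ρ u - r.ρ u') * frobNorm (r.ρ (x j) - r.ρ a) *
            m i j) := mul_le_mul_of_nonneg_left hdd hβ
        _ = Dw * dG u u' := by simp only [hDw, hdG]; ring
    -- the one-link variance bound along the interpolation (the analytic input)
    have hP : ∀ t ∈ Set.Icc (0 : ℝ) 1, ∀ (ψ' : G → ℝ) (M' : ℝ), Measurable ψ' →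
        (∃ C, ∀ g, |ψ' g| ≤ C) → 0 ≤ M' → (∀ a b, |ψ' a - ψ' b| ≤ M' * dG a b) →
        ∫ g, (ψ' g - ∫ g', ψ' g' ∂((haarProbability G).tilted fun u => f u + t * w u)) ^ 2
          ∂((haarProbability G).tilted fun u => f u + t * w u) ≤ M' ^ 2 / (s / K₁) := by
      intro t ht ψ' M' hψ'm hψ'b hM' hψ'L
      -- the slot structure of the torus and the word data of the two backgrounds
      set E : Plaquette 4 (2 * S + 1) → Fin 4 → Edge 4 (2 * S + 1) := fun p =>
        ![(p.1, p.2.1.1), (p.1.shift p.2.1.1, p.2.1.2), (p.1.shift p.2.1.2, p.2.1.1), (p.1, p.2.1.2)]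
        with hE
      set wv : Plaquette 4 (2 * S + 1) ⊕ Plaquette 4 (2 * S + 1) → ℝ :=
        Sum.elim (fun _ => 1 - t) (fun _ => t) with hwv
      set vv : Plaquette 4 (2 * S + 1) ⊕ Plaquette 4 (2 * S + 1) → Fin 4 → Option G :=
        Sum.elim (fun p k => if E p k = i then none else some (x (E p k)))
          (fun p k => if E p k = i then none else some (update x j a (E p k))) with hvv
      have hwv1 : ∀ m, |wv m| ≤ 1 := by
        rintro (p | p)
        · simp only [hwv, Sum.elim_inl]; rw [abs_of_nonneg (by linarith [ht.2])]; linarith [ht.1]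
        · simp only [hwv, Sum.elim_inr]; rw [abs_of_nonneg ht.1]; exact ht.2
      -- at most `2 · 16` words see the link `i`
      have hcount : ∀ T : Finset (Plaquette 4 (2 * S + 1) ⊕ Plaquette 4 (2 * S + 1)),
          (∀ m ∈ T, ∃ k, vv m k = none) → T.card ≤ 32 := by
        intro T hT
        have hni : ∀ m ∈ T, (1 : ℝ) ≤ ∑ k : Fin 4, if E (Sum.elim id id m) k = i then (1 : ℝ) else 0 := by
          intro m hm
          obtain ⟨k, hk⟩ := hT m hm
          have hk' : E (Sum.elim id id m) k = i := by
            rcases m with p | p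
            · simp only [hvv, Sum.elim_inl] at hk
              show E p k = i
              by_contra hne; simp [hne] at hk
            · simp only [hvv, Sum.elim_inr] at hk
              show E p k = i
              by_contra hne; simp [hne] at hk
          calc (1 : ℝ) = if E (Sum.elim id id m) k = i then (1 : ℝ) else 0 := by rw [if_pos hk']
            _ ≤ ∑ k' : Fin 4, if E (Sum.elim id id m) k' = i then (1 : ℝ) else 0 :=
              Finset.single_le_sum (f := fun k' => if E (Sum.elim id id m) k' = i then (1 : ℝ) else 0)
                (fun _ _ => by positivity) (Finset.mem_univ k)
        have h16 := Lattice.sum_slotCount_le (d := 4) (L := 2 * S + 1) i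
        have hcard : (T.card : ℝ) ≤ 32 := by
          calc (T.card : ℝ) = ∑ _m ∈ T, (1 : ℝ) := by simp
            _ ≤ ∑ m ∈ T, ∑ k : Fin 4, if E (Sum.elim id id m) k = i then (1 : ℝ) else 0 :=
                Finset.sum_le_sum hni
            _ ≤ ∑ m, ∑ k : Fin 4, if E (Sum.elim id id m) k = i then (1 : ℝ) else 0 :=
                Finset.sum_le_sum_of_subset_of_nonneg (Finset.subset_univ _)
                  fun m _ _ => Finset.sum_nonneg fun k _ => by positivity
            _ = (∑ p : Plaquette 4 (2 * S + 1), ∑ k : Fin 4, if E p k = i then (1 : ℝ) else 0) +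
                  ∑ p : Plaquette 4 (2 * S + 1), ∑ k : Fin 4, if E p k = i then (1 : ℝ) else 0 := by
                rw [Fintype.sum_sum_type]; rfl
            _ ≤ 4 * (4 : ℕ) + 4 * (4 : ℕ) := add_le_add h16 h16
            _ = 32 := by norm_num
        exact_mod_cast hcard
      -- the interpolated one-link law is the pinned word-tilted Haar measure of the hypothesis
      have hgetD : ∀ (y : GaugeConfig 4 (2 * S + 1) G) (p : Plaquette 4 (2 * S + 1)) (k : Fin 4)
          (g : G), ((if E p k = i then none else some (y (E p k))) : Option G).getD g =
            update y i g (E p k) := fun y p k g => by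
        by_cases hk : E p k = i
        · simp [hk]
        · simp [hk]
      have hwords : ∀ (y : GaugeConfig 4 (2 * S + 1) G) (g : G), wilsonAction r.ρ (update y i g) =
          ∑ p : Plaquette 4 (2 * S + 1), ((r.N : ℝ) -
            (r.ρ (((if E p 0 = i then none else some (y (E p 0))) : Option G).getD g) *
              r.ρ (((if E p 1 = i then none else some (y (E p 1))) : Option G).getD g) *
              (r.ρ (((if E p 2 = i then none else some (y (E p 2))) : Option G).getD g))ᴴ *
              (r.ρ (((if E p 3 = i then none else some (y (E p 3))) : Option G).getD g))ᴴ).trace.re) :=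
        fun y g => by
          simp only [hgetD]
          exact Lattice.wilsonAction_eq_sum_words r.ρ r.mem_unitary (update y i g)
      have hcore : ((haarProbability G).tilted fun u => f u + t * w u) =
          (haarProbability G).tilted (fun g => s * (r.ρ ((X i)⁻¹ * g)).trace.re +
            β * ∑ m, wv m * (r.ρ ((vv m 0).getD g) * r.ρ ((vv m 1).getD g) *
              (r.ρ ((vv m 2).getD g))ᴴ * (r.ρ ((vv m 3).getD g))ᴴ).trace.re) := by
        have hfun : (fun u => f u + t * w u) = fun g =>
            (s * ∑ ℓ ∈ Finset.univ.erase i, (r.ρ ((X ℓ)⁻¹ * x ℓ)).trace.re +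
              t * s * (∑ ℓ ∈ Finset.univ.erase i, (r.ρ ((X ℓ)⁻¹ * update x j a ℓ)).trace.re -
                ∑ ℓ ∈ Finset.univ.erase i, (r.ρ ((X ℓ)⁻¹ * x ℓ)).trace.re) -
              β * (Fintype.card (Plaquette 4 (2 * S + 1)) * r.N)) +
            (s * (r.ρ ((X i)⁻¹ * g)).trace.re +
              β * ∑ m, wv m * (r.ρ ((vv m 0).getD g) * r.ρ ((vv m 1).getD g) *
                (r.ρ ((vv m 2).getD g))ᴴ * (r.ρ ((vv m 3).getD g))ᴴ).trace.re) := by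
          funext g
          simp only [hf, hw, hV, hpin, Lattice.sum_pin_update, hwords, Fintype.sum_sum_type, hwv, hvv,
            Sum.elim_inl, Sum.elim_inr, Finset.sum_sub_distrib, Finset.sum_const, Finset.card_univ,
            nsmul_eq_mul, ← Finset.mul_sum]
          ring
        rw [hfun]
        exact tilted_const_add_eq _ _ _
      rw [hcore]
      exact hOL' β hβ s hsc₀ (X i) _ wv vv hwv1 hcount ψ' M' hψ'm hψ'b hM' hψ'L
    have hK : 0 < s / K₁ := div_pos hspos hK₁
    have hkr := abs_integral_tilted_add_sub_le (μ := haarProbability G) (r := dG) hfm hfb hwm hwB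
      hψm ⟨Mψ, hψb⟩ hK hL0 hDw0 hψL hwD hP
    rw [hfw] at hkr
    rw [abs_sub_comm]
    refine hkr.trans (le_of_eq ?_)
    simp only [hDw, hc]
    field_simp
  -- the abstract theorem
  have key := HeatBath.variance_le_of_kr (ι := Edge 4 (2 * S + 1)) (haarProbability G) hVm hVb dG
    hdc hd0 hdnn hdsymm hdtri hdsep hdD c (κ₀ := 1 / 2) (by norm_num) (by norm_num) hcsum hKR hF hM
  -- identification of the pinned measure and of its one-link laws
  have hμ : (wilsonMeasure (d := 4) (L := 2 * S + 1) r.ρ β).tilted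
      (fun W => s * ∑ ℓ, (r.ρ ((X ℓ)⁻¹ * W ℓ)).trace.re) =
      (Measure.pi fun _ : Edge 4 (2 * S + 1) => haarProbability G).tilted V := by
    rw [Literature.MathematicalPhysics.QuantumLattice.wilsonMeasure_eq_tilted_pi r.ρ r.continuous β,
      tilted_tilted]
    · rfl
    · refine Integrable.of_bound (((measurable_wilsonAction r.ρ r.continuous).const_mul _).exp
        |>.aestronglyMeasurable) (Real.exp (|β| * B₁)) (ae_of_all _ fun U => ?_)
      rw [Real.norm_eq_abs, Real.abs_exp, Real.exp_le_exp]
      calc -β * wilsonAction r.ρ U ≤ |-β * wilsonAction r.ρ U| := le_abs_self _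
        _ = |β| * |wilsonAction r.ρ U| := by rw [abs_mul, abs_neg]
        _ ≤ |β| * B₁ := mul_le_mul_of_nonneg_left (hB₁ U) (abs_nonneg _)
  have hν : ∀ (U : GaugeConfig 4 (2 * S + 1) G) (ℓ : Edge 4 (2 * S + 1)),
      ((haarProbability G).tilted fun e => V (update U ℓ e)) =
      (haarProbability G).tilted (fun g' => -β * wilsonAction r.ρ (update U ℓ g') +
        s * (r.ρ ((X ℓ)⁻¹ * g')).trace.re) := fun U ℓ => by
    have hfun : (fun e => V (update U ℓ e)) = fun g' =>
        s * (∑ ℓ' ∈ Finset.univ.erase ℓ, (r.ρ ((X ℓ')⁻¹ * U ℓ')).trace.re) +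
        (-β * wilsonAction r.ρ (update U ℓ g') + s * (r.ρ ((X ℓ)⁻¹ * g')).trace.re) := by
      funext g'
      simp only [hV, hpin, Lattice.sum_pin_update]
      ring
    rw [hfun]
    exact tilted_const_add_eq _ _ _
  rw [hμ]
  simp_rw [hν] at key
  norm_num at key
  simpa using key

end Summit.QuantumFields.YangMills.Theorems.StrongPinningPoincare

end
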